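import Summits.HodgeConjecture.HodgeConjecture.Theorems.F0P6aDatumOfInputsDefs
import Literature.AlgebraicGeometry.AbelianSchemes.SerreCoverLayerIsoOfReducedRecognition
import Literature.AlgebraicGeometry.AbelianSchemes.FibreRecognitionOfSerreCover
import Literature.AlgebraicGeometry.AbelianSchemes.FibreRecognitionTransport
import Literature.AlgebraicGeometry.Motives.GaloisThickeningFrobeniusSheetwise
import Literature.AlgebraicGeometry.AbelianSchemes.SerreTensorBaseChange
import Literature.AlgebraicGeometry.GroupSchemes.AdmissibleIdealTransportCanonical
import Literature.AlgebraicGeometry.GroupSchemes.IdealKernelLayerIso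
import Literature.AlgebraicGeometry.GroupSchemes.HopfIdealTransportFactor
import Summits.HodgeConjecture.HodgeConjecture.Theorems.F0P6aSpecOrgansT
import Summits.HodgeConjecture.HodgeConjecture.Theorems.F0P6aStubFROBQuotWD
import Literature.AlgebraicGeometry.AbelianSchemes.LevelStructureCoprimeChar
import HarnessLib
import HarnessLib.Audit.LibrarySuggestionsDenyListCruxes

/-!
# `F0P6aStubDOWN` — ★ RE-HOME (K6, L2 column, LAST member = the LEAF) of the crux workfile `Lines/F0_P6a_StubDOWN.lean` — L2 closer leaf of the D-LINE socket `stub_DOWN`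

**SIZE-LINT SPLIT ×7** (`Theorems/` files with proofs are ≤ 400 lines): parts `Theorems/F0P6aStubDOWNLaws.lean` → `Theorems/F0P6aStubDOWNProvider.lean` → `Theorems/F0P6aStubDOWNSpecKey.lean` → `Theorems/F0P6aStubDOWNSpecHeads.lean` → `Theorems/F0P6aStubDOWNOrgans.lean` → `Theorems/F0P6aStubDOWNTransport.lean` → `Theorems/F0P6aStubDOWN.lean`, each importing the previous, cut at declaration boundaries of `Lines/F0_P6a_StubDOWN.lean`; namespaces AND sections KEPT and re-opened per part (with their `open`∕`variable` lines replayed verbatim); the options preamble is repeated. This is PART 1.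

This `Theorems/` module chain is the TREE BYTES of `Summits/HodgeConjecture/HodgeConjecture/Cruxes/HLiu418/Lines/F0_P6a_StubDOWN.lean` (edition of record ED. 5,
tree sha16 e250f7eaf0d80e96, 1984 l., 85 declaration commands, code-`sorry`-free, head `stub_DOWN_of_organs` axioms TRIO) with the NAMESPACE KEPT —
`Summit.HodgeConjecture.HodgeConjecture.Cruxes.HLiu418.F0P6aStubDOWN` — so that every fully-qualified name is UNCHANGED; only this module docstring is re-headed,
the three `Lines` imports are switched to their ★ re-homed twins (`Lines.F0_P6a_DatumOfInputs` → ★ `Theorems.F0P6aDatumOfInputsDefs` = the K5-H2 «hub twin minus sockets», LAST part;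
`Lines.F0_P6a_SpecOrgansT` → ★ `Theorems.F0P6aSpecOrgansT`; `Lines.F0_P6a_StubRHO1` → ★ `Theorems.F0P6aStubRHO1`), the build-lane carrier `HarnessLib.Audit.LibrarySuggestionsDenyListCruxes` is KEPT on this root part
(«P-κ», LEAD F0P6-plan (g6) «M-142d» (1)), the locators in the docstrings of the two text-closed `Prop`s `SheetDecompLaw`∕`SheetDisjoint` are spelled `(print: …)`
(gate-relocation pre-cure, LA-ref1 (g5) BOX K5 #R1; LA2-plan (g5) PLAN v1.2 Δ4), and the hub-typed junction certificate at the end is re-typed over the ★ closed socket type `StubDOWNType` of ★ `Theorems.F0P6aDatumOfInputsDefs` (`example : StubDOWNType := @stub_DOWN_of_organs`, ORDER-CERTIFIED against `stub_DOWN` by LA2-p01 (g5) (H1b′) 3c0ce4e28dfd824d).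
Why a re-home: a `Theorems/` file cannot import a `Lines/` workfile (F0P6-ref1 o-6), and closing stmt-HodgeConjecture-24832 `--as proved --by <Theorems decl>` at rung 0 needs the
sorry-free `Lines` chain behind the gate (RE-HOME TABLE v1.7, LA7-plan (g7); PLAN «L2 cone RE-HOME» v1.2, LA2-plan (g5); LEAD F0P6-plan (g5) «M-140» (1)∕(4), 2026-09-02).
`Lines` importer of the original: MAIN `Lines/F0_P6a_ModuliDatum.lean` (reads `F0P6aStubDOWN.stub_DOWN_of_organs` BY NAME).  After the chain is ★ the `Lines` workfile becomes a
one-import SHIM of `Theorems.F0P6aStubDOWN` (a `Lines/` write, batched per cone on the LEAD՚s word), so no environment holds two copies (NO-CROSS-IMPORT, «M-72» (3)).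
It asserts nothing beyond what the workfile already proves.  HC_CM is proved only modulo the 7 printed citations (2 remaining: hLiu418 = stmt-HodgeConjecture-24832,
h413 = stmt-HodgeConjecture-24833) until rung 0 closes; a re-home is count-neutral.  (Cand: LA2-p03 (g7), HOME-only, generator `k6/mk_leaf_whole.py` + `k6/tools/split_multi2.py`.)

**v3 (LA2-plan DEAL 8a; «M-142g» (A)(d2) + «M-142h» (iii′)):** two text-identical restatements of heads that land ★ earlier in the K6 order are treated — `exists₂_dropLast` (≡ ★ `…F0P6aStubFROBQuotWD.exists₂_take₈`) is KEPT AS AN `alias` of that ★ name (FQN preserved, no call-site patch; `import …Theorems.F0P6aStubFROBQuotWD` added), and the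
whole `section PendingHeads` (the by-term letter `stub_RHO1` ≡ ★ `…F0P6aLineSpecialisation.exists_quotLegReduction`) is NOT re-homed: `stub_SPEC`՚s payment term is re-spelled by that ★ FQN and the letter
is restored hub-side in the `Lines/` shim (FQN `…F0P6aStubDOWN.stub_RHO1` survives there; 0 readers; MAIN reads `stub_DOWN_of_organs` only). Every other byte as in the set of record `canon.v2Pk`.

## Import provenance (the workfile՚s header comments, moved here so that the header is CANONICAL — bare `import` lines, snapshottable on the farm; LEAD F0P6-plan (g6) «M-141» (6))
- `Summits.HodgeConjecture.HodgeConjecture.Theorems.F0P6aDatumOfInputsDefs` — ★ twin (K5-H2 LAST part, desk F0P6c-plan (g8)) of the D-LINE hub `Lines.F0_P6a_DatumOfInputs` MINUS its sockets  ∕ was: -- D-LINE ED. 1 8205f0b2 (served 01:38Z): `stub_DOWN` :515, carriers, `SpecReadings`, `DownReadings`, the named laws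
- `Literature.AlgebraicGeometry.AbelianSchemes.SerreCoverLayerIsoOfReducedRecognition` — ★ (R9′) ED. 4 `exists_layerIso_of_fibreRecognition_of_rank` (p849064)
- `Literature.AlgebraicGeometry.AbelianSchemes.FibreRecognitionOfSerreCover` — ★ (HREC) `exists_fibreRecognitionPkg_of_cover` (LA2-p03 (g2), p849497)
- `Literature.AlgebraicGeometry.AbelianSchemes.FibreRecognitionTransport` — ★ `fibreRecognitionPkg_transport` (p849410)
- `Literature.AlgebraicGeometry.Motives.GaloisThickeningFrobeniusSheetwise` — ★ `geomReductionMap_thickeningLift_comp_symm`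
- `Literature.AlgebraicGeometry.AbelianSchemes.SerreTensorBaseChange` — ★ `isCommMonObj_baseChange`
- `Literature.AlgebraicGeometry.GroupSchemes.AdmissibleIdealTransportCanonical` — ★ p847946 (T-can) canonicity of admissible transport [ED. 3, stub_TRANSPORT]
- `Literature.AlgebraicGeometry.GroupSchemes.IdealKernelLayerIso` — ★ p847791 (θ-0) `exists_admissible_transport` [ED. 3]
- `Literature.AlgebraicGeometry.GroupSchemes.HopfIdealTransportFactor` — ★ p849016 `quotIncl_comp_comp_eq_one_of_comap` (LA6-p01 (g2)) [ED. 3, (E8)]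
- `Summits.HodgeConjecture.HodgeConjecture.Theorems.F0P6aSpecOrgansT` — ★ twin (K6, LAST part — ASSUMED plain-stem name) of `Lines.F0_P6a_SpecOrgansT`  ∕ was: -- [ED. 4] the ORGAN HEADS leaflets PART A∕B (LA2-p01 (g2) fold; PART B imports PART A): `hrkG_of_dock`, (ρ3-K) ×3, (T-WD), D6 sheet head (+ LS ED. 2 `spGeoOf` laws by import)
- `Summits.HodgeConjecture.HodgeConjecture.Theorems.F0P6aStubFROBQuotWD` — ★ twin (K6, LAST part — ASSUMED plain-stem name) of `Lines.F0_P6a_StubFROBQuotWD`: home of `exists₂_take₈` (= the leaf՚s `exists₂_dropLast` verbatim), reserve v3 only («M-142g» (A))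
- `Literature.AlgebraicGeometry.AbelianSchemes.LevelStructureCoprimeChar` — [ED. 4] ★ p850254 `LevelStructure.coprime_of_charP` (`p ∤ N` inside §Σ)
- `HarnessLib`
- `HarnessLib.Audit.LibrarySuggestionsDenyListCruxes` — «P-κ» (LEAD F0P6-plan (g6) «M-142d» (1)): the ROOT part of every K6 ★ twin keeps the `Cruxes` deny-list carrier, directly after `import HarnessLib`  ∕ was: -- [ED. 4″] build-lane export guard (operator companion, req547; LEAD «M-119b»): deny-list entry "Cruxes" for the LibrarySuggestions export fold — ADD-ONLY, no statement/proof/axiom affected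
- `Summits.HodgeConjecture.HodgeConjecture.Theorems.F0P6aStubRHO1` — ★ twin (K6, LAST part — ASSUMED plain-stem name) of `Lines.F0_P6a_StubRHO1`  ∕ was: -- [ED. 5] the (ρ1𝒞) leaflet: `exists_quotLegReduction` (0 sorry) = the `stub_RHO1` socket text

## Original module docstring (verbatim)
**ED. 5** = ED. 4″ + `StubRHO1` BY IMPORT; s0.  The last socket is PAID BY NAME: `import …Lines.F0_P6a_StubRHO1` (the (ρ1𝒞) leaflet, 0 sorry) and
`stub_RHO1`՚s body := the one-name payment by `…F0P6aLineSpecialisation.exists_quotLegReduction` ((e5) hunk; statement bytes untouched); nothing else.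
Sorries 1 → **0**: `stub_DOWN_of_organs` is closed-derived sorry-free (axioms TRIO) ⇒ the D-LINE socket `stub_DOWN` :515 is payable BY NAME.

**ED. 4** (by-paste cand, LA2-p04 (g2), 2026-09-02 09:4xZ; dealer LA2-plan (g2) deal 09:29:54Z (2)) = ED. 3 1567c10a6c5d3157 with organ **`stub_SPEC` PAID OVER THE ORGAN
HEADS**: ADD-ONLY — two imports (`Lines.F0_P6a_SpecOrgansT` = PART B of the organ-heads bank, importing PART A `Lines.F0_P6a_SpecOrgans`; ★ p850254), one `open … (…)` of the
served heads by name, §Σ (the (Σ) assembly `stub_SPEC_keyOn` ∕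
`stub_SPEC_of_heads`, HOME v2 22ed505c, 0 sorry, TRIO, every decl ≤ 400 000) and §Σ′ (ONE NAMED finer socket `stub_RHO1` = the (ρ1𝒞) v3 head type, body `sorry` — ED. 5
replaces it by ONE served name; the [WQ] head `red₀Of_quotΩ_eq_of_quotLegReduction₀` is SERVED in PART B `Lines/F0_P6a_SpecOrgansT.lean` §Q (LA6-p01 (g3); LA2-plan (g2)
ruling 11:06:20Z «§Q folds into PART B») and enters `stub_SPEC`՚s payment term BY NAME) inserted before §1, and `stub_SPEC`՚s `sorry` replaced by the payment term; statements of
all four organs, the head and the junction UNCHANGED token for token.  Sorries 1 (`stub_SPEC`) → 1 (`stub_RHO1`, strictly smaller and = the producer's head text).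

# L2 CLOSER LEAF `Lines/F0_P6a_StubDOWN.lean` — D-LINE socket `stub_DOWN`, EDITION 2 (LA2-plan (g0) dealer∕co-pen; organ `stub_LAYERISO` PAID by LA2-p03 (g2))

**ED. 3** (by-paste cand, LA2-p01 (g0), 2026-09-02 07:2xZ; dealer LA2-plan (g2) (R1) 07:12:37Z) = ED. 2 e8b5a608ea1b4aa4 with organ **`stub_TRANSPORT` PAID** in-line
(HOME payment `F0/P6/L2/LA2-p01/g0/StubTRANSPORT.payment.v1.LA2-p01g0.lean` 4d4dce1f160689d2, 0 sorry, TRIO, junction type-for-type): ADD-ONLY — three ★ imports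
(p847946 (T-can), p847791 (θ-0), p849016 `HopfIdealTransportFactor`), ONE helper block §1.3′ (transport machinery §A′–§E: `actOf` action, sheet coordinates `τOf`∕`base`,
canonical admissible transport `transportSub`, layer isos `layerIso`∕`smapT`, the transported readings `quotT`∕`translT`∕`isogT` and their nine rows, + `specT`) placed
immediately BEFORE the organ, and `stub_TRANSPORT`՚s `sorry` replaced by the payment term; statements of all four organs, the head and the junction UNCHANGED token for token.
Sorries 1 = {`stub_SPEC`}.  KERNEL NOTE (E8): the dock-level `IsogKerLaw` row is `isogKerLaw_transport_of_eq … (isogT … x̄ H) rfl` with every point spelled as in the bodies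
of `quotT`∕`isogT` (no `base` inside the readings) — any respelling under a `≫`∕`1` head makes the KERNEL (not the elaborator) descend the `Over (Spec κ) → Scheme → LRS`
composition tower (> 600 s measured); keep letter-identical in later editions.

ED. 2 = ED. 1 a462fc58d2c5fd8b (tree commit 87c87c2b921d; itself = closer skeleton v2 with `stub_SHEETS` paid in-line, ★ SHEET-COVER) with organ **`stub_LAYERISO` PAID**
in-line by LA2-p03 (g2) (HOME payment `StubLAYERISO.hrec.v1.LA2-p03g2.lean` c92006f9575491b1, 0 sorry, TRIO, junction type-for-type): ADD-ONLY — five ★ imports,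
the helper block §0b (§A `actOf_mul` [LA2-p01 (g0)], §B (b2) sheet extension `layerIsoLaw_of_sheet` [LA2-p04 (g0) 6ef4de93], §C the `e`-sheet head
`layerIso_on_sheet_of_fibreRecognition` [LA2-p03 (g0) fold v4 2fcf977d; ★ (R9′) `exists_layerIso_of_fibreRecognition_of_rank` p849064], §D (HREC) the provider
`hrec_of_inputs` [LA2-p03 (g2); ★ `exists_fibreRecognitionPkg_of_cover` p849497 on row 40 `I.coverKerΩ`, ★ `fibreRecognitionPkg_transport` p849410]) pasted ABOVE the
organs, and `stub_LAYERISO`՚s `sorry` replaced by the payment term; statements of all four organs, the head and the junction UNCHANGED token for token.  Sorries 2 =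
{`stub_SPEC` (LA2-p02 cut SP4-by-choice, sub-skeleton 56b8ab18; LS leaflet), `stub_TRANSPORT` (LA2-p01 (g0), leaf-based payment in cure)}.  ROAD ACTUALLY TAKEN for
`stub_LAYERISO` (supersedes the ED. 1 docstring՚s return-isogeny sketch, kept below as the record of the deal): SHEET EXTENSION — by `stub_SHEETS` every special point is
`θ(σ,1)_s (red₀ y)`, and `actOf` is a left action (§A), so an `𝒪_F`-equivariant dock-layer iso for every pair (sheet point, its `τ`-translate) extends to all pairs (§B,
composition∕inverse of `DockIsoAt`); on the `e`-sheet the iso comes from ★ (R9′) FIBRE RECOGNITION: the Serre cover `c : A_{e,y} → A_{e∘τ⁻¹,y}` of row 40 `I.coverKerΩ`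
(`Ker c = A[𝔞_τ]` scheme-theoretically) reduces along the two integral points (★ (ν8k) `exists_specialFibre_hom_reduction_ker_ringAction`) to a recognition package
«`A_{θx̄} ≅ A_{x̄} ⊗_{𝒪_F} 𝔞⁻¹` under `A_{x̄}`» (§D, ★ p849497 + ★ p849410), and ★ (R9′) turns the package into an equivariant iso of the `𝔭_{c•w}`-layers of equal rank
`q²` (`hrkG₀`), docked through `hkerG₀`∕`hι₀G`∕`hβ₀G` (§C).  No coprimality of `𝔞_τ` with `c•w` is used (junk-robust, LA2-p03 (θ-!)).

The served socket `stub_DOWN` :515 (`… → Nonempty (DownReadings I 𝔡 quotΩ translΩ)`) is read TOKEN FOR TOKEN (junction `example : type_of% @stub_DOWN := @stub_DOWN_of_organs`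
below) and cut into FOUR organs along the ONE seam the interface forces.  `DownReadings` is a single interlinked record: `quot_smap` makes `quot` θ-consistent on ALL special
sheets, while `red_quotΩ` ∕ (L1′) `I.inj₀` pin it only on the `e`-SHEET (the image of `red₀Of … e`); so any cut that hands `sp ∕ quot ∕ isogW₀` downstream as free binders with
only the `SpecReadings` laws is FALSE off the `e`-sheet (junk values).  Hence SHEET ∕ θ-GEOMETRY ∕ TRANSPORT:
* `stub_SPEC` (KERNEL-IDEAL SPECIALISATION road; LA2-p02 owner, LA2-p01 co-payer of the D6 ∕ K-layer conjuncts) — «THE `e`-SHEET READINGS WITH THEIR LAWS»: there are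
  `sp quot transl isogW₀` with `red_quotΩ`, `red_translΩ`, (b4′) `canonicalLine₀`, SP-surjectivity, and the three NAMED K-laws `IsogHomLaw` ∕ `IsogKerLaw` ∕ `QuotQuot₀Law`
  of the D-line VERBATIM.  Geometric on the `e`-sheet (SP4 `quot := red₀ ∘ quotΩ ∘ lift`, well defined by `I.inj₀`; `isogW₀ :=` the `c•w`-layer map of `d ∘ q`; D6 by ROAD H =
  ★ HBT + (H4′) + (H5)); OFF the sheet the three K-laws are met by constant ∕ trivial values, which `stub_TRANSPORT` discards — so NO `θ` anywhere in this organ.  Size L.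
* `stub_SHEETS` (θ-geometry road, light half; LA2-p01) — «EVERY SPECIAL POINT IS A `θ(τ,1)_s`-TRANSLATE OF AN `e`-SHEET REDUCTION»: from `_hθ` (generic `θ(τ,1)` = deck action),
  ★ `geomReductionMap_surjective_of_isSmoothProper`, ★ sheetwise reduction `geomReductionMap_thickeningLift_comp_symm`, `Fᵢ∕F` Galois.  Size S–M.
* `stub_LAYERISO` (θ-geometry road, heavy half; LA2-p03) — «THE `c•w`-LAYERS OF THE DOCKS AT `x̄` AND `θ(τ,1)_s x̄` ARE ISOMORPHIC, `𝒪_F`-EQUIVARIANTLY»: the iso is an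
  OUTPUT (existential) because `RGDInputsAt` carries no `θ`-structure on `univ` (LA2-p03 (θ-!)); supplier = the RETURN-ISOGENY ROUTE: the return isogeny `d_a` of the
  Serre cover (L5) `I.coverΩ` for `a ∈ 𝔞_γ` of exact `c•w`-valuation has `Ker d_a ⊥ c•w` (`Ker c = A[𝔞_γ]` exactly by (t1)(t2) + `twistNorm_spec`), so its reduction
  (★ (ν7)∕(ν8)) is a mono of equal rank on the `c•w`-layers — junk-robust, no coprimality of `𝔞_γ` assumed.  Size L.
* `stub_TRANSPORT` (assembly ∕ transport road; LA2-p03, swappable with LA2-p01) — «SHEET READINGS EXTEND θ-EQUIVARIANTLY»: along the UNIQUE decomposition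
  `x̄ = θ(τ,1)_s (red₀ y)` (uniqueness = `_hdisj` + the group law of `actOf`), keep the sheet values, transport `quot ∕ transl ∕ isogW₀` by conjugation with the layer isos,
  `smap :=` ★ admissible transport along ANY layer iso (= the combinatorial map, `SubOf ⊆ {kerF, étale}` by ★ `eq_kerFI_or_idealIsEtale_of_isAdm`, both canonical ⇒
  cocycle-free `quot_smap`), `smap_kerF` = ★ `comap_appTop_ker_kerι_relFrobeniusOver`; D6 off the sheet = D6 on the sheet transported (the second point `quot x̄₀ H` is on
  the sheet by SP-surjectivity + `red_quotΩ`).  Size M.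
HEAD `stub_DOWN_of_organs` = `stub_DOWN`՚s statement, sorry-free over the four organs.  Every law is its own `Prop` (Defs :803 lesson: no declaration elaborates the dock
tower twice).  HC_CM is proved only modulo the 7 printed citations (2 remaining named inputs: hLiu418 24832, h413 24833) until rung 0 closes; HOME-only, nothing
registered, count-neutral.
-/

set_option autoImplicit false
set_option linter.dupNamespace false

noncomputable section


namespace Summit.HodgeConjecture.HodgeConjecture.Cruxes.HLiu418.F0P6aStubDOWN

open CategoryTheory CategoryTheory.Limits NumberField IsDedekindDomain MulAction
open scoped Matrix Polynomial Pointwise MonoidalCategory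
open Literature.NumberTheory.GaloisRepresentations
open Literature.NumberTheory.Automorphic Literature.NumberTheory.Automorphic.UnitaryGroup
open Literature.AlgebraicGeometry.ShimuraVarieties.UnitaryCanonicalModel
open Literature.NumberTheory.Automorphic.Liu2021.AppendixC
open Literature.AlgebraicGeometry.Motives (AlgPoints IntegralModel SchemeOver thickening thickeningGalAction thickeningLift specOver relFrobeniusOver frobeniusTwistOver)
open Literature.NumberTheory.DiophantineGeometry (geomResidueField specialFibreFunctor specResidueField)
open Literature.AlgebraicGeometry.RelativeSpec (ActionOver)
open Literature.NumberTheory.EllipticCurves (genericFibre)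
open Literature.AlgebraicGeometry.GroupSchemes.AffineGroupScheme (Alg quotIncl)
open Summit.HodgeConjecture.HodgeConjecture.Cruxes.HLiu418.F0P6cDictConstructors (kerFI AdmSub IdealIsEtale isAdm_kerFI)
open Summit.HodgeConjecture.HodgeConjecture.Cruxes.HLiu418.F0P6aModuliDatumDefs
open Summit.HodgeConjecture.HodgeConjecture.Cruxes.HLiu418.F0P6aRGDAssembly
open Summit.HodgeConjecture.HodgeConjecture.Cruxes.HLiu418.F0P6aDatumOfInputs
open Summit.HodgeConjecture.HodgeConjecture.Cruxes.HLiu418.F0P6aLineSpecialisation (spGeoOf canonicalLine_spGeoOf spGeoOf_surjective hrkG_of_dock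
  exists_isogW₀_of_quotLeg mono_coverPin₀ le_ker_isogW₀_of_himg red₀Of_translΩ_eq_of_red₀Of_eq red₀Of_quotΩ_eq_red₀Of_translΩ_of_le_ker_layer
  red₀Of_quotΩ_eq_of_quotLegReduction₀)  -- [ED. 4] organ heads BY NAME (incl. the §Q head `red₀Of_quotΩ_eq_of_quotLegReduction₀`, PART B)

/-! ### §0 THE LAWS, each its own `Prop` (field texts of `SpecReadings` VERBATIM where they exist) -/

section Laws

-- the frame of the tree՚s `Letters` section VERBATIM
variable {F : Type} [Field F] [NumberField F] [IsCMField F] {ι₁ : F →+* ℂ}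
    {Jstar : Matrix (Fin 2) (Fin 2) F}
    {K₀ : C5.OpenCompactSubgroup ↥(finAdelic ↥(maximalRealSubfield F) F (IsCMField.complexConj F) 2 Jstar)}
    {S : RecordSystemGS F Jstar ι₁ K₀} {hU7ₛ : S.HeckeTranslateDefinedOver}
    {hJ : (Jstar.map (IsCMField.complexConj F))ᵀ = Jstar} {hJu : IsUnit Jstar}
    {Fi : Type} [Field Fi] [Algebra F Fi] {Kc : C5.SmallLevel K₀} {G : Type} [Group G]
    {𝓜 : IntegralModel (𝓞 F) F ((thickening F Fi).obj (S.M.obj Kc))}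
    {w : HeightOneSpectrum (𝓞 F)} {hw : (IsCMField.complexConj F) • w ≠ w} {h𝓨 : (𝓜.localise w).IsSmoothProper 1}
    {θ : ActionOver (𝓜.localise w).total.hom ((Fi ≃ₐ[F] Fi) × G)}
    {e : Fi →ₐ[F] AlgebraicClosure (w.adicCompletion F)}

variable (S) (Kc) (𝓜) (w) (h𝓨) (θ) (e) in
/-- (ℓ1) **`SheetDecompLaw` — EVERY SPECIAL POINT IS A `θ(τ,1)_s`-TRANSLATE OF AN `e`-SHEET REDUCTION**: `∀ x̄, ∃ τ y, θ(τ,1)_s (red₀ y) = x̄`.  A definition.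
(print: SerreTate1968, §1 Lemma 2) (print: GortzWedhorn2020, (14.20)) -/
def SheetDecompLaw : Prop :=
  ∀ xbar : AlgPoints (𝓜.localise w).reductionAt (geomResidueField w),
    ∃ (τ : Fi ≃ₐ[F] Fi) (y : AlgPoints (S.M.obj Kc) (AlgebraicClosure (w.adicCompletion F))),
      actOf S Kc 𝓜 w θ τ (red₀Of S Kc 𝓜 w h𝓨 e y) = xbar

variable (S) (Kc) (𝓜) (w) (h𝓨) (e) in
/-- (c2) **`RedTranslLaw` — `red₀` COMMUTES WITH THE IDEAL TRANSLATION** (the `SpecReadings.red_translΩ` text).  A definition. [cite: Liu2021, p. 137] -/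
def RedTranslLaw
    (translΩ : AlgPoints (S.M.obj Kc) (AlgebraicClosure (w.adicCompletion F)) → AlgPoints (S.M.obj Kc) (AlgebraicClosure (w.adicCompletion F)))
    (transl : AlgPoints (𝓜.localise w).reductionAt (geomResidueField w) → AlgPoints (𝓜.localise w).reductionAt (geomResidueField w)) : Prop :=
  ∀ y, red₀Of S Kc 𝓜 w h𝓨 e (translΩ y) = transl (red₀Of S Kc 𝓜 w h𝓨 e y)

variable (I : RGDInputsAt F ι₁ Jstar K₀ S hU7ₛ hJ hJu Fi Kc G 𝓜 w hw h𝓨 θ e) [ExpChar (geomResidueField w) I.pChar]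

/-- (c2) **`RedQuotLaw` — `red₀` COMMUTES WITH THE MODULI QUOTIENT** (the `SpecReadings.red_quotΩ` text).  A definition. [cite: Liu2021, p. 137] -/
def RedQuotLaw (𝔡 : ∀ xbar, DockAt I xbar)
    (quotΩ : ∀ y, LineOf I y → AlgPoints (S.M.obj Kc) (AlgebraicClosure (w.adicCompletion F)))
    (sp : ∀ y, LineOf I y → SubOf I 𝔡 (red₀Of S Kc 𝓜 w h𝓨 e y))
    (quot : ∀ xbar, SubOf I 𝔡 xbar → AlgPoints (𝓜.localise w).reductionAt (geomResidueField w)) : Prop :=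
  ∀ y (L : LineOf I y), red₀Of S Kc 𝓜 w h𝓨 e (quotΩ y L) = quot (red₀Of S Kc 𝓜 w h𝓨 e y) (sp y L)

/-- (b4′) **`CanonicalLineLaw` — THE CANONICAL LINE** (the `SpecReadings.canonicalLine₀` text; ★ `CanonicalLine.existsUnique_admK_spI_eq_kerFI`).  A definition.
[cite: Liu2021, p. 137] [cite: Carayol1986Compositio, §10.3 Prop. p. 211] -/
def CanonicalLineLaw (𝔡 : ∀ xbar, DockAt I xbar) (sp : ∀ y, LineOf I y → SubOf I 𝔡 (red₀Of S Kc 𝓜 w h𝓨 e y)) : Prop :=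
  ∀ y, (∃ H : SubOf I 𝔡 (red₀Of S Kc 𝓜 w h𝓨 e y), IsEtaleOf I 𝔡 H) →
    ∃ L₀ : LineOf I y, sp y L₀ = kerFOf I 𝔡 (red₀Of S Kc 𝓜 w h𝓨 e y) ∧ ∀ L : LineOf I y, sp y L = kerFOf I 𝔡 (red₀Of S Kc 𝓜 w h𝓨 e y) → L = L₀

/-- (SP-surj) **`SpSurjLaw` — EVERY ADMISSIBLE SUBGROUP AT `red₀ y` IS THE SPECIALISATION OF A LINE AT `y`** (ordinary: the canonical line ↦ `Ker F`, the other `q` lines ↦ the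
étale member; supersingular: `Sub = {Ker F}`; ★ `AdmissibleIdealSpecialFibreSurjective`).  A definition. [cite: Liu2021, p. 137] [cite: Tate1997FiniteFlatGroupSchemes, (3.7)] -/
def SpSurjLaw (𝔡 : ∀ xbar, DockAt I xbar) (sp : ∀ y, LineOf I y → SubOf I 𝔡 (red₀Of S Kc 𝓜 w h𝓨 e y)) : Prop :=
  ∀ y (H : SubOf I 𝔡 (red₀Of S Kc 𝓜 w h𝓨 e y)), ∃ L : LineOf I y, sp y L = H

set_option maxHeartbeats 400000 in
/-- (θ-iso) **`LayerIsoLaw` — THE `c•w`-LAYERS OF THE DOCKS AT `x̄` AND AT `θ(τ,1)_s x̄` ARE ISOMORPHIC AS GROUP SCHEMES, `𝒪_F`-EQUIVARIANTLY** (`A_{θ x̄}[𝔭_{c•w}] ≅ (A_x̄ ⊗ 𝔞_τ)[𝔭_{c•w}]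
≅ A_x̄[𝔭_{c•w}]`; the currency of ★ `AdmissibleIdealTransport` ∕ `IdealKernelLayerIso`).  A definition. [cite: RapoportSmithlingZhang2020Diagonal, Lemma 3.4–Prop. 3.7, pp. 12–14] [cite: Tate1997FiniteFlatGroupSchemes, (3.7)] -/
def LayerIsoLaw (𝔡 : ∀ xbar, DockAt I xbar) : Prop :=
  ∀ (τ : Fi ≃ₐ[F] Fi) (xbar : AlgPoints (𝓜.localise w).reductionAt (geomResidueField w)),
    letI := (𝔡 xbar).grp₀; letI := (𝔡 (actOf S Kc 𝓜 w θ τ xbar)).grp₀;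
    ∃ φ : (𝔡 xbar).G₀ ≅ (𝔡 (actOf S Kc 𝓜 w θ τ xbar)).G₀,
      IsMonHom φ.hom ∧ ∀ a : 𝓞 F, (𝔡 xbar).β₀ a ≫ φ.hom = φ.hom ≫ (𝔡 (actOf S Kc 𝓜 w θ τ xbar)).β₀ a

end Laws

/-! ## §0b LAYERISO MACHINERY (leaf ED. 2; the HOME payment c92006f9575491b1 of LA2-p03 (g2), §A–§D VERBATIM, opens scoped per section) -/

/-! ### §A `actOf` is a left action (LA2-p01 (g0) §A VERBATIM) -/

section ActionLaw
open AlgebraicGeometry Literature.AlgebraicGeometry.AbelianSchemes Literature.AlgebraicGeometry.AbelianSchemes.AbelianSchemeOver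

open scoped MonObj Obj

variable {F : Type} [Field F] [NumberField F] [IsCMField F] {ι₁ : F →+* ℂ}
    {Jstar : Matrix (Fin 2) (Fin 2) F}
    {K₀ : C5.OpenCompactSubgroup ↥(finAdelic ↥(maximalRealSubfield F) F (IsCMField.complexConj F) 2 Jstar)}
    {S : RecordSystemGS F Jstar ι₁ K₀} {hU7ₛ : S.HeckeTranslateDefinedOver}
    {hJ : (Jstar.map (IsCMField.complexConj F))ᵀ = Jstar} {hJu : IsUnit Jstar}
    {Fi : Type} [Field Fi] [Algebra F Fi] {Kc : C5.SmallLevel K₀} {G : Type} [Group G]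
    {𝓜 : IntegralModel (𝓞 F) F ((thickening F Fi).obj (S.M.obj Kc))}
    {w : HeightOneSpectrum (𝓞 F)} {hw : (IsCMField.complexConj F) • w ≠ w} {h𝓨 : (𝓜.localise w).IsSmoothProper 1}
    {θ : ActionOver (𝓜.localise w).total.hom ((Fi ≃ₐ[F] Fi) × G)}
    {e : Fi →ₐ[F] AlgebraicClosure (w.adicCompletion F)}

set_option maxHeartbeats 400000 in
/-- `θ.aut` on the first factor is ANTI-multiplicative in the `≫` order (`Aut` multiplies by `flip Iso.trans`). [cite: GortzWedhorn2020, (14.20)] -/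
theorem aut_mul_hom (σ τ : Fi ≃ₐ[F] Fi) : (θ.aut (σ * τ, 1)).hom = (θ.aut (τ, 1)).hom ≫ (θ.aut (σ, 1)).hom := by
  have h : ((σ * τ, (1 : G)) : (Fi ≃ₐ[F] Fi) × G) = (σ, 1) * (τ, 1) := by rw [Prod.mk_mul_mk, mul_one]
  rw [h, map_mul]
  rfl

set_option maxHeartbeats 400000 in
/-- The model automorphisms `θ(γ, 1)` over the base compose ANTI-multiplicatively. [cite: GortzWedhorn2020, (14.20)] -/
theorem isoMk_aut_mul_hom (σ τ : Fi ≃ₐ[F] Fi) :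
    (Over.isoMk (θ.aut (σ * τ, 1)) (θ.aut_comp (σ * τ, 1))).hom =
      (Over.isoMk (θ.aut (τ, 1)) (θ.aut_comp (τ, 1))).hom ≫ (Over.isoMk (θ.aut (σ, 1)) (θ.aut_comp (σ, 1))).hom :=
  Over.OverMorphism.ext (aut_mul_hom σ τ)

set_option maxHeartbeats 400000 in
/-- **`actOf (σ * τ) = actOf σ ∘ actOf τ`** — `θ(·,1)_s` is a LEFT action on the special points. [cite: GortzWedhorn2020, (14.20)] -/
theorem actOf_mul (σ τ : Fi ≃ₐ[F] Fi) (p : AlgPoints (𝓜.localise w).reductionAt (geomResidueField w)) :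
    actOf S Kc 𝓜 w θ (σ * τ) p = actOf S Kc 𝓜 w θ σ (actOf S Kc 𝓜 w θ τ p) := by
  have h1 : (specialFibreFunctor w).map (Over.isoMk (θ.aut (σ * τ, 1)) (θ.aut_comp (σ * τ, 1))).hom =
      (specialFibreFunctor w).map (Over.isoMk (θ.aut (τ, 1)) (θ.aut_comp (τ, 1))).hom ≫
        (specialFibreFunctor w).map (Over.isoMk (θ.aut (σ, 1)) (θ.aut_comp (σ, 1))).hom := by
    rw [← Functor.map_comp, isoMk_aut_mul_hom]
  exact (congrArg (fun f => p ≫ f) h1).trans (Category.assoc _ _ _).symm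

end ActionLaw

/-! ### §B (b2) SHEET EXTENSION (LA2-p04 (g0) 6ef4de93 VERBATIM) -/

section SheetExt
open AlgebraicGeometry Literature.AlgebraicGeometry.AbelianSchemes Literature.AlgebraicGeometry.AbelianSchemes.AbelianSchemeOver

variable {F : Type} [Field F] [NumberField F] [IsCMField F] {ι₁ : F →+* ℂ}
    {Jstar : Matrix (Fin 2) (Fin 2) F}
    {K₀ : C5.OpenCompactSubgroup ↥(finAdelic ↥(maximalRealSubfield F) F (IsCMField.complexConj F) 2 Jstar)}
    {S : RecordSystemGS F Jstar ι₁ K₀} {hU7ₛ : S.HeckeTranslateDefinedOver}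
    {hJ : (Jstar.map (IsCMField.complexConj F))ᵀ = Jstar} {hJu : IsUnit Jstar}
    {Fi : Type} [Field Fi] [Algebra F Fi] {Kc : C5.SmallLevel K₀} {G : Type} [Group G]
    {𝓜 : IntegralModel (𝓞 F) F ((thickening F Fi).obj (S.M.obj Kc))}
    {w : HeightOneSpectrum (𝓞 F)} {hw : (IsCMField.complexConj F) • w ≠ w} {h𝓨 : (𝓜.localise w).IsSmoothProper 1}
    {θ : ActionOver (𝓜.localise w).total.hom ((Fi ≃ₐ[F] Fi) × G)}
    {e : Fi →ₐ[F] AlgebraicClosure (w.adicCompletion F)}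

set_option maxHeartbeats 400000 in
open scoped MonObj CategoryTheory.Obj in
/-- **`DockIsoAt I 𝔡 p q`** — THE `c•w`-LAYERS OF THE DOCKS AT `p` AND AT `q` ARE ISOMORPHIC AS GROUP SCHEMES, `𝒪_F`-EQUIVARIANTLY: the summand of `LayerIsoLaw I 𝔡` with BOTH
special points free (`LayerIsoLaw I 𝔡 ↔ ∀ τ x̄, DockIsoAt I 𝔡 x̄ (θ(τ)_s x̄)` is `Iff.rfl`).  A definition (plumbing: lets `refl ∕ symm ∕ trans` be proved once, each in its own budget).
[cite: RapoportSmithlingZhang2020Diagonal, Lemma 3.4–Prop. 3.7, pp. 12–14] [cite: Tate1997FiniteFlatGroupSchemes, (3.7)] -/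
def DockIsoAt (I : RGDInputsAt F ι₁ Jstar K₀ S hU7ₛ hJ hJu Fi Kc G 𝓜 w hw h𝓨 θ e) [ExpChar (geomResidueField w) I.pChar] (𝔡 : ∀ xbar, DockAt I xbar)
    (p q : AlgPoints (𝓜.localise w).reductionAt (geomResidueField w)) : Prop :=
  letI := (𝔡 p).grp₀; letI := (𝔡 q).grp₀;
  ∃ ψ : (𝔡 p).G₀ ≅ (𝔡 q).G₀, IsMonHom ψ.hom ∧ ∀ a : 𝓞 F, (𝔡 p).β₀ a ≫ ψ.hom = ψ.hom ≫ (𝔡 q).β₀ a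

set_option maxHeartbeats 400000 in
/-- `LayerIsoLaw I 𝔡` IS `DockIsoAt` along every `θ(τ)_s`-translation — by `Iff.rfl`. [cite: RapoportSmithlingZhang2020Diagonal, Lemma 3.4–Prop. 3.7, pp. 12–14] -/
theorem layerIsoLaw_iff_dockIsoAt (I : RGDInputsAt F ι₁ Jstar K₀ S hU7ₛ hJ hJu Fi Kc G 𝓜 w hw h𝓨 θ e) [ExpChar (geomResidueField w) I.pChar]
    (𝔡 : ∀ xbar, DockAt I xbar) :
    LayerIsoLaw I 𝔡 ↔ ∀ (τ : Fi ≃ₐ[F] Fi) (xbar : AlgPoints (𝓜.localise w).reductionAt (geomResidueField w)), DockIsoAt I 𝔡 xbar (actOf S Kc 𝓜 w θ τ xbar) :=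
  Iff.rfl

set_option maxHeartbeats 400000 in
set_option synthInstance.maxHeartbeats 100000 in
open scoped MonObj CategoryTheory.Obj in
/-- `DockIsoAt` IS REFLEXIVE ALONG A POINT EQUALITY (transport `p = q`: after `subst`, the identity of `(𝔡 p).G₀`). [cite: Tate1997FiniteFlatGroupSchemes, (3.7)] -/
theorem dockIsoAt_of_eq (I : RGDInputsAt F ι₁ Jstar K₀ S hU7ₛ hJ hJu Fi Kc G 𝓜 w hw h𝓨 θ e) [ExpChar (geomResidueField w) I.pChar]
    (𝔡 : ∀ xbar, DockAt I xbar) {p q : AlgPoints (𝓜.localise w).reductionAt (geomResidueField w)} (h : p = q) : DockIsoAt I 𝔡 p q := by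
  subst h
  letI := (𝔡 p).grp₀
  refine ⟨Iso.refl _, ?_, fun a => ?_⟩
  · rw [Iso.refl_hom]
    infer_instance
  · rw [Iso.refl_hom]
    exact (Category.comp_id _).trans (Category.id_comp _).symm

set_option maxHeartbeats 400000 in
set_option synthInstance.maxHeartbeats 100000 in
open scoped MonObj CategoryTheory.Obj in
/-- `DockIsoAt` IS SYMMETRIC (the inverse iso is a homomorphism — Mathlib՚s `IsMonHom f.inv` — and `𝒪_F`-equivariant). [cite: Tate1997FiniteFlatGroupSchemes, (3.7)] -/
theorem DockIsoAt.symm {I : RGDInputsAt F ι₁ Jstar K₀ S hU7ₛ hJ hJu Fi Kc G 𝓜 w hw h𝓨 θ e} [ExpChar (geomResidueField w) I.pChar]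
    {𝔡 : ∀ xbar, DockAt I xbar} {p q : AlgPoints (𝓜.localise w).reductionAt (geomResidueField w)} (h : DockIsoAt I 𝔡 p q) : DockIsoAt I 𝔡 q p := by
  letI := (𝔡 p).grp₀
  letI := (𝔡 q).grp₀
  obtain ⟨ψ, hm, hψ⟩ := h
  haveI := hm
  refine ⟨ψ.symm, ?_, fun a => ?_⟩
  · rw [Iso.symm_hom]
    infer_instance
  · rw [Iso.symm_hom]
    exact ψ.comp_inv_eq.mpr ((ψ.eq_inv_comp.mpr (hψ a).symm).trans (Category.assoc _ _ _).symm)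

set_option maxHeartbeats 400000 in
set_option synthInstance.maxHeartbeats 100000 in
open scoped MonObj CategoryTheory.Obj in
/-- `DockIsoAt` IS TRANSITIVE (composite of homomorphisms, `𝒪_F`-equivariant). [cite: Tate1997FiniteFlatGroupSchemes, (3.7)] -/
theorem DockIsoAt.trans {I : RGDInputsAt F ι₁ Jstar K₀ S hU7ₛ hJ hJu Fi Kc G 𝓜 w hw h𝓨 θ e} [ExpChar (geomResidueField w) I.pChar]
    {𝔡 : ∀ xbar, DockAt I xbar} {p q r : AlgPoints (𝓜.localise w).reductionAt (geomResidueField w)} (h₁ : DockIsoAt I 𝔡 p q) (h₂ : DockIsoAt I 𝔡 q r) :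
    DockIsoAt I 𝔡 p r := by
  letI := (𝔡 p).grp₀
  letI := (𝔡 q).grp₀
  letI := (𝔡 r).grp₀
  obtain ⟨ψ₁, hm₁, hψ₁⟩ := h₁
  obtain ⟨ψ₂, hm₂, hψ₂⟩ := h₂
  haveI := hm₁
  haveI := hm₂
  refine ⟨ψ₁ ≪≫ ψ₂, ?_, fun a => ?_⟩
  · rw [Iso.trans_hom]
    infer_instance
  · rw [Iso.trans_hom]
    -- no `rw [Category.assoc]` here: a FAILING `comp =?= comp` unification on these scheme morphisms unfolds `Over ∕ Scheme ∕ LRS ∕ PresheafedSpace` composition (whnf blow-up)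
    exact ((Category.assoc _ _ _).symm.trans (eq_whisker (hψ₁ a) ψ₂.hom)).trans
      (((Category.assoc _ _ _).trans (whisker_eq ψ₁.hom (hψ₂ a))).trans (Category.assoc _ _ _).symm)

set_option maxHeartbeats 400000 in
/-- **SHEET EXTENSION, `DockIsoAt` FORM**: if every special point is `θ(σ)_s (red₀ y)` (`SheetDecompLaw`), the special action is multiplicative (`hmul`) and `DockIsoAt` holds from
every `e`-sheet reduction to each of its `θ(τ)_s`-translates, then `DockIsoAt I 𝔡 x̄ (θ(τ)_s x̄)` for EVERY `x̄`: at `x̄ = θ(σ)_s (red₀ y)` compose `(red₀ y → θ(σ)_s red₀ y)⁻¹`,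
`red₀ y → θ(τσ)_s red₀ y` and the transport along `θ(τσ)_s red₀ y = θ(τ)_s θ(σ)_s red₀ y`. [cite: SerreTate1968, §1 Lemma 2] [cite: RapoportSmithlingZhang2020Diagonal, Lemma 3.4–Prop. 3.7, pp. 12–14] -/
theorem dockIsoAt_act_of_sheet (I : RGDInputsAt F ι₁ Jstar K₀ S hU7ₛ hJ hJu Fi Kc G 𝓜 w hw h𝓨 θ e) [ExpChar (geomResidueField w) I.pChar]
    (𝔡 : ∀ xbar, DockAt I xbar) (hsheets : SheetDecompLaw S Kc 𝓜 w h𝓨 θ e)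
    (hmul : ∀ (γ₁ γ₂ : Fi ≃ₐ[F] Fi) (p : AlgPoints (𝓜.localise w).reductionAt (geomResidueField w)),
      actOf S Kc 𝓜 w θ (γ₁ * γ₂) p = actOf S Kc 𝓜 w θ γ₁ (actOf S Kc 𝓜 w θ γ₂ p))
    (hs : ∀ (τ : Fi ≃ₐ[F] Fi) (y : AlgPoints (S.M.obj Kc) (AlgebraicClosure (w.adicCompletion F))),
      DockIsoAt I 𝔡 (red₀Of S Kc 𝓜 w h𝓨 e y) (actOf S Kc 𝓜 w θ τ (red₀Of S Kc 𝓜 w h𝓨 e y)))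
    (τ : Fi ≃ₐ[F] Fi) (xbar : AlgPoints (𝓜.localise w).reductionAt (geomResidueField w)) : DockIsoAt I 𝔡 xbar (actOf S Kc 𝓜 w θ τ xbar) := by
  obtain ⟨σ, y, rfl⟩ := hsheets xbar
  exact ((hs σ y).symm.trans (hs (τ * σ) y)).trans (dockIsoAt_of_eq I 𝔡 (hmul τ σ (red₀Of S Kc 𝓜 w h𝓨 e y)))

set_option maxHeartbeats 400000 in
set_option synthInstance.maxHeartbeats 100000 in
open scoped MonObj CategoryTheory.Obj in
/-- **SHEET EXTENSION — `LayerIsoLaw` ON THE `e`-SHEET ⇒ `LayerIsoLaw` EVERYWHERE.**  If every special point is a `θ(σ,1)_s`-translate of an `e`-sheet reduction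
(`SheetDecompLaw`, ★ `stub_SHEETS` PAID), the special action is multiplicative (`hmul : θ(γ₁γ₂)_s = θ(γ₁)_s θ(γ₂)_s`, LITERALLY LA1-p02's GREEN §A `actOf_mul` — LA2-plan 03:50:26Z ruling (1)) and the layer isos exist at
the sheet points (`hsheet τ y : (𝔡 (red₀ y)).G₀ ≅ (𝔡 (θ(τ)_s (red₀ y))).G₀`, hom, `β₀`-equivariant — the output of `stub_LAYERISO`՚s return-isogeny road at the `e`-sheet), then
`LayerIsoLaw I 𝔡`: at `x̄ = θ(σ)_s (red₀ y)` the iso towards `θ(τ)_s x̄ = θ(τσ)_s (red₀ y)` is `(φ_{σ,y})⁻¹ ≫ φ_{τσ,y}` (then transported along `hmul`).  Term-mode over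
`dockIsoAt_act_of_sheet` (the hypothesis `hsheet` IS `∀ τ y, DockIsoAt I 𝔡 (red₀ y) (θ(τ)_s red₀ y)` by `rfl`).
[cite: RapoportSmithlingZhang2020Diagonal, Lemma 3.4–Prop. 3.7, pp. 12–14] [cite: Tate1997FiniteFlatGroupSchemes, (3.7)] [cite: SerreTate1968, §1 Lemma 2] -/
theorem layerIsoLaw_of_sheet (I : RGDInputsAt F ι₁ Jstar K₀ S hU7ₛ hJ hJu Fi Kc G 𝓜 w hw h𝓨 θ e) [ExpChar (geomResidueField w) I.pChar]
    (𝔡 : ∀ xbar, DockAt I xbar) (hsheets : SheetDecompLaw S Kc 𝓜 w h𝓨 θ e)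
    (hmul : ∀ (γ₁ γ₂ : Fi ≃ₐ[F] Fi) (p : AlgPoints (𝓜.localise w).reductionAt (geomResidueField w)),
      actOf S Kc 𝓜 w θ (γ₁ * γ₂) p = actOf S Kc 𝓜 w θ γ₁ (actOf S Kc 𝓜 w θ γ₂ p))
    (hsheet : ∀ (τ : Fi ≃ₐ[F] Fi) (y : AlgPoints (S.M.obj Kc) (AlgebraicClosure (w.adicCompletion F))),
      letI := (𝔡 (red₀Of S Kc 𝓜 w h𝓨 e y)).grp₀; letI := (𝔡 (actOf S Kc 𝓜 w θ τ (red₀Of S Kc 𝓜 w h𝓨 e y))).grp₀;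
      ∃ φ : (𝔡 (red₀Of S Kc 𝓜 w h𝓨 e y)).G₀ ≅ (𝔡 (actOf S Kc 𝓜 w θ τ (red₀Of S Kc 𝓜 w h𝓨 e y))).G₀,
        IsMonHom φ.hom ∧ ∀ a : 𝓞 F, (𝔡 (red₀Of S Kc 𝓜 w h𝓨 e y)).β₀ a ≫ φ.hom = φ.hom ≫ (𝔡 (actOf S Kc 𝓜 w θ τ (red₀Of S Kc 𝓜 w h𝓨 e y))).β₀ a) :
    LayerIsoLaw I 𝔡 :=
  (layerIsoLaw_iff_dockIsoAt I 𝔡).mpr (dockIsoAt_act_of_sheet I 𝔡 hsheets hmul hsheet)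

end SheetExt

/-! ### §C THE `e`-SHEET HEAD OVER AN ABSTRACT FIBRE FAMILY (LA2-p03 (g0) fold v4 2fcf977d VERBATIM) -/

section Fold
open AlgebraicGeometry Literature.AlgebraicGeometry.AbelianSchemes Literature.AlgebraicGeometry.AbelianSchemes.AbelianSchemeOver

variable {F : Type} [Field F] [NumberField F] [IsCMField F] {ι₁ : F →+* ℂ}
    {Jstar : Matrix (Fin 2) (Fin 2) F}
    {K₀ : C5.OpenCompactSubgroup ↥(finAdelic ↥(maximalRealSubfield F) F (IsCMField.complexConj F) 2 Jstar)}
    {S : RecordSystemGS F Jstar ι₁ K₀} {hU7ₛ : S.HeckeTranslateDefinedOver}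
    {hJ : (Jstar.map (IsCMField.complexConj F))ᵀ = Jstar} {hJu : IsUnit Jstar}
    {Fi : Type} [Field Fi] [Algebra F Fi] {Kc : C5.SmallLevel K₀} {G : Type} [Group G]
    {𝓜 : IntegralModel (𝓞 F) F ((thickening F Fi).obj (S.M.obj Kc))}
    {w : HeightOneSpectrum (𝓞 F)} {hw : (IsCMField.complexConj F) • w ≠ w} {h𝓨 : (𝓜.localise w).IsSmoothProper 1}
    {θ : ActionOver (𝓜.localise w).total.hom ((Fi ≃ₐ[F] Fi) × G)}
    {e : Fi →ₐ[F] AlgebraicClosure (w.adicCompletion F)}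

end Fold
end Summit.HodgeConjecture.HodgeConjecture.Cruxes.HLiu418.F0P6aStubDOWN
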